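import Literature.NumberTheory.Automorphic.Liu2021.LemD1AsPrintedIndexedNonVacuityTameCarrier
import Literature.NumberTheory.Automorphic.Liu2021.LemD1AsPrintedIndexedNonVacuityRamifiedPlace
import Literature.NumberTheory.Automorphic.Liu2021.LemD1AsPrintedIndexedNonVacuityAtPlace
import Literature.NumberTheory.GaloisRepresentations.CharacterPrescribedLocalComponentsProofs
import Literature.NumberTheory.QuadraticForms.GlobalSquareTheorem
import Mathlib.Analysis.SpecialFunctions.Complex.Log
import HarnessLib

/-!
# [Liu2021, App. D §D.1 Step 2] — a Step-2 datum at EVERY non-split place `∤ 2` of ANY quadratic extension `E/F`, the RAMIFIED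
# places included, by EXTENSION of the norm-class character: the printed Step-2 index set is non-empty at every place `∤ 2`

Reproduction ∕ bookkeeping (Literature, THEOREMS ONLY: no definition, no record, no named fact, no `sorry`; nothing is
asserted about Liu's oscillator representations or about the tree's constructed local Weil carriers).

Sequel of `LemD1AsPrintedIndexedNonVacuityInertSign.lean` (the unramified sign character at the INERT places — «What this does NOT give:
the RAMIFIED non-split places (… a Step-2 datum at a ramified place of a general `E/F` needs an extension of the local quadratic character
…, not constructed)»), of `…RamifiedPlace.lean` (at a ramified place every Step-2 datum is ramified; a norm uniformiser; a non-norm unit),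
`…NonsplitPlace.lean` (the norm group has index EXACTLY `2`), `…TameTwist.lean` ∕ `…TameCarrier.lean` (a second element; the joint
certificate), and of the tree's local square theorem `QuadraticForms.isSquare_of_valued_sub_one_lt` [Omeara1963, §63A Cor. 63:1b] and
character-extension lemma `ClozelHarrisTaylor2008.exists_character_comp_eq` (`ℚ/ℤ` is divisible, [ClozelHarrisTaylor2008, Lem. 4.1.1, proof]).
Setting: the tree's place model of a quadratic `E/F` at a finite place `v ∤ 2` (`F_v`, `E_v = Π_{w∣v} E_w`, `c ⊗ 1`, `c δ = −δ ≠ 0`), a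
place `w ∣ v` fixed by `c` — inert OR ramified.

* §1 (private) the exponential `e : ℚ/ℤ → ℂˣ`, `q ↦ e^{2πiq}` — a homomorphism, injective, UNITARY (trimmed copy of the tree's private
  lemma, with the norm statement added).
* §2 **`isNorm_of_valued_sub_one_lt`**: at `v ∤ 2` every principal unit `a` of `F_v` (`v(a − 1) < 1 = v(4)`) is a square (local square
  theorem), hence a norm `ι_v(r) · (c ⊗ 1) ι_v(r)` from `E_vˣ`.  **`exists_stepTwo_of_nonsplit`** (MAIN): the `ℚ/ℤ`-valued norm-class
  character `c_N` of `F_vˣ` (`0` on the norm group `N`, `1/2` off it; additive because `[F_vˣ : N] = 2`, Mathlib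
  `Subgroup.mul_mem_iff_of_index_two`) kills every `a` with `ι_w a ∈ U¹_w = 1 + 𝔭_w` (such `a` are principal units of `F_v`, §2), so it
  extends along `F_vˣ → E_wˣ/U¹_w` to an additive `φ : E_wˣ/U¹_w → ℚ/ℤ`; `μ := e ∘ φ ∘ (E_vˣ → E_wˣ → E_wˣ/U¹_w)` is a Step-2 datum of
  the place model in the rows' displayed binder shape: unitary (`e` is), continuous (kernel `⊇ U¹_w`, open), «`μ(ι_v a) = 1 ↔ a ∈ Nm E_vˣ`»
  (`e` injective, `c_N(a) = 0 ↔ a ∈ N`), and TAME (trivial on the units `≡ 1 (mod 𝔭_w)`).  This is [NeukirchANT1999, Ch. V §1 Thm. (1.3)]'s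
  norm-class character `F_vˣ/N_{E_w/F_v}E_wˣ ≅ G(E_w|F_v) = {±1}` extended to `E_wˣ`.
* §3 consequences for ANY quadratic `E/F`: **`exists_muSet_tame_of_nonsplit`** (the printed Step-2 index set `LemD1.MuSet (LemD1OfPlace.standingData …)`
  is non-empty at every non-split place `∤ 2` — ramified places included), **`nonempty_muSet_of_not_two_mem`** (non-empty at EVERY place
  `∤ 2`: split by `…AtPlace.one_mem_muSet_of_split`, non-split by §2) with cofinite form **`eventually_nonempty_muSet`** (all but the
  finitely many places above `2`), **`exists_muSet_ne_of_nonsplit`** (TWO elements at every non-split place `∤ 2`, by the tame twist),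
  **`exists_muSet_and_forall_not_unramified_of_ramified`** (at a RAMIFIED place `∤ 2`: non-empty and EVERY element ramified — contrast the
  inert places, `…InertSign`: exactly one unramified element), and the hypothesis-free teeth ∕ certificates at every place `∤ 2`:
  **`not_forall_lemD1_3_of_item1_of_not_two_mem`** ((3) AS PRINTED is not a consequence of (1), rank `N ≥ 3`),
  **`not_forall_mu_eq_of_not_two_mem`** ((1) ∧ (3) do not force equal μ-labels, `N` odd `≥ 3`).

What this does NOT give: the places above `2` (wild; the local square theorem then needs `v(a − 1) < v(4)`); an explicit formula for the
datum at a ramified place (it is an abstract extension; its restriction to `ι_v(𝒪_vˣ)` is the Legendre symbol of the residue field, not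
recorded here); anything about the CM rows beyond `…NonsplitPlace` (they have their own `μ_v` everywhere); carriers; Lem. D.1 itself.
HC_CM is NOT proved.

Cell pub-hodgecm2 (COR-CM), audit class of the END rows `hD1''` ∕ `hD3`; seat prover-pub-hodgecm2-b10.

References: [Liu2021] Y. Liu, *Fourier–Jacobi cycles and arithmetic relative trace formula*, Camb. J. Math. 9 (2021) =
arXiv:2102.11518, App. D §D.1 Step 2 (`FJcycle.tex` l. 5219), Lemma D.1 (1) (l. 5229), (3) (l. 5233); [NeukirchANT1999] J. Neukirch,
*Algebraic Number Theory* (1999), Ch. V §1 Thm. (1.3) (local reciprocity `G(L|K)^{ab} ≅ K^*/N_{L|K}L^*`) and Cor. (1.2); [Omeara1963]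
O. T. O'Meara, *Introduction to Quadratic Forms* (1963), §63A Cor. 63:1b (local squares are open), §63B Cor. 63:13a (the local norm index
`2`); [ClozelHarrisTaylor2008] L. Clozel, M. Harris, R. Taylor, Publ. Math. IHÉS 108 (2008), Lemma 4.1.1 (p. 116), proof («extend this
character»); [CasselsFrohlichANT1967] Ch. II §10.
-/

noncomputable section

open scoped Matrix MatrixGroups
open NumberField IsDedekindDomain
open Literature.RepresentationTheory
open Literature.NumberTheory.QuadraticForms (quadraticNormSubgroup)
open Literature.NumberTheory.GaloisRepresentations (HeckeCharacter)

namespace Literature.NumberTheory.Automorphic.Liu2021.LemD1IndexedNonVacuityNormClassExtension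

open UnitaryGroup

/-! ## §1 The exponential `ℚ/ℤ → ℂˣ` (unitary, injective) -/

/-- the character `ℚ/ℤ → ℂˣ`, `q ↦ e^{2πiq}`: a homomorphism, injective, with values of norm `1` (trimmed copy of the private
lemma of `CharacterPrescribedLocalComponentsProofs`). [folklore] -/
private theorem exists_addCircle_character :
    ∃ e : AddCircle (1 : ℚ) → ℂˣ, e 0 = 1 ∧ (∀ x y, e (x + y) = e x * e y) ∧
      Function.Injective e ∧ ∀ x, ‖((e x : ℂˣ) : ℂ)‖ = 1 := by
  let E : ℚ →+ Additive ℂˣ :=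
    { toFun := fun q => Additive.ofMul (Units.mk0 (Complex.exp (2 * Real.pi * Complex.I * (q : ℂ))) (Complex.exp_ne_zero _))
      map_zero' := by
        apply Additive.toMul.injective
        apply Units.ext
        simp
      map_add' := fun q q' => by
        apply Additive.toMul.injective
        apply Units.ext
        simp only [toMul_ofMul, Units.val_mk0, toMul_add, Units.val_mul, Rat.cast_add, mul_add,
          Complex.exp_add] }
  have hE : ∀ q : ℚ, ((Additive.toMul (E q) : ℂˣ) : ℂ) = Complex.exp (2 * Real.pi * Complex.I * (q : ℂ)) := fun q => rfl
  have hker : AddSubgroup.zmultiples (1 : ℚ) ≤ E.ker := by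
    intro q hq
    obtain ⟨n, rfl⟩ := AddSubgroup.mem_zmultiples_iff.mp hq
    rw [AddMonoidHom.mem_ker]
    apply Additive.toMul.injective
    apply Units.ext
    rw [hE]
    change Complex.exp (2 * Real.pi * Complex.I * ((n • (1 : ℚ) : ℚ) : ℂ)) = ((1 : ℂˣ) : ℂ)
    rw [Units.val_one, zsmul_one, Rat.cast_intCast,
      show 2 * (Real.pi : ℂ) * Complex.I * (n : ℂ) = n * (2 * Real.pi * Complex.I) by ring]
    exact Complex.exp_int_mul_two_pi_mul_I n
  let ē : AddCircle (1 : ℚ) →+ Additive ℂˣ := QuotientAddGroup.lift _ E hker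
  have hē : ∀ q : ℚ, ē (q : AddCircle (1 : ℚ)) = E q := fun q => QuotientAddGroup.lift_mk' _ _ q
  refine ⟨fun x => Additive.toMul (ē x), ?_, fun x y => ?_, fun x y hxy => ?_, fun x => ?_⟩
  · show Additive.toMul (ē 0) = 1
    rw [map_zero]; rfl
  · show Additive.toMul (ē (x + y)) = Additive.toMul (ē x) * Additive.toMul (ē y)
    rw [map_add]; rfl
  · have hxy' : ē x = ē y := Additive.toMul.injective hxy
    rw [← sub_eq_zero, ← map_sub] at hxy'
    rw [← sub_eq_zero]
    induction x using QuotientAddGroup.induction_on with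
    | H qx =>
    induction y using QuotientAddGroup.induction_on with
    | H qy =>
    rw [← QuotientAddGroup.mk_sub, hē] at hxy'
    rw [← QuotientAddGroup.mk_sub, QuotientAddGroup.eq_zero_iff]
    have h1 : Complex.exp (2 * Real.pi * Complex.I * ((qx - qy : ℚ) : ℂ)) = 1 := by
      rw [← hE, hxy']; rfl
    obtain ⟨n, hn⟩ := Complex.exp_eq_one_iff.mp h1
    have hπ : (2 * Real.pi * Complex.I : ℂ) ≠ 0 := by simp [Real.pi_ne_zero, Complex.I_ne_zero]
    have h2 : ((qx - qy : ℚ) : ℂ) = (n : ℂ) :=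
      mul_right_cancel₀ hπ (by rw [mul_comm]; exact hn)
    have h3 : (qx - qy : ℚ) = (n : ℚ) := by exact_mod_cast h2
    rw [h3]
    exact AddSubgroup.mem_zmultiples_iff.mpr ⟨n, by rw [zsmul_one]⟩
  · induction x using QuotientAddGroup.induction_on with
    | H q =>
    show ‖((Additive.toMul (ē (q : AddCircle (1 : ℚ))) : ℂˣ) : ℂ)‖ = 1
    rw [hē, hE, Complex.norm_exp]
    simp

/-! ## §2 A Step-2 datum at EVERY non-split place `∤ 2` of ANY quadratic `E/F` (inert or ramified), by extension of the norm-class character -/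

section PlaceModel

variable {F : Type} (E : Type) [Field F] [NumberField F] [Field E] [NumberField E] [Algebra F E]
  [Algebra.IsQuadraticExtension F E] (v : HeightOneSpectrum (𝓞 F)) (c : E ≃ₐ[F] E)
  {δ : E} (hcδ : c δ = -δ) (hδ : δ ≠ 0)

include hcδ hδ in
/-- `δ² ∈ F` (copy of the private lemma of `LemD1IndexedNonVacuityNonsplitPlace`). [folklore] -/
private theorem exists_delta_mul_self_eq_algebraMap : ∃ d : F, δ * δ = algebraMap F E d := by
  obtain ⟨x, y, hxy⟩ := exists_eq_add_mul_of_isQuadraticExtension (F := F) (E := E)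
    (not_mem_range_algebraMap_of_apply_eq_neg E c hcδ hδ) (δ * δ)
  have hc2 : c (δ * δ) = δ * δ := by rw [map_mul, hcδ, neg_mul_neg]
  have hy : algebraMap F E y * δ = 0 := by
    have h1 : c (δ * δ) = algebraMap F E x - algebraMap F E y * δ := by
      rw [hxy, map_add, map_mul, AlgEquiv.commutes, AlgEquiv.commutes, hcδ, mul_neg, sub_eq_add_neg]
    rw [hc2, hxy] at h1
    have h2 : (2 : E) * (algebraMap F E y * δ) = 0 := by linear_combination h1
    exact (mul_eq_zero.1 h2).resolve_left two_ne_zero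
  exact ⟨x, by rw [hxy, hy, add_zero]⟩

omit [Algebra.IsQuadraticExtension F E] in
/-- squares of `F_vˣ` are norms from `E_vˣ`: `ι_v(r) · (c ⊗ 1)(ι_v r) = ι_v(r²)`. [cite: Liu2021, App. D §D.1 Step 2 (l. 5219)] -/
private theorem isNorm_of_sq (r : (v.adicCompletion F)ˣ) :
    ∃ x : (LocalRing E v)ˣ, (x : LocalRing E v) * conjLocal E c v x =
      algebraMap (v.adicCompletion F) (LocalRing E v) ((r * r : (v.adicCompletion F)ˣ) : v.adicCompletion F) :=
  ⟨Units.map (algebraMap (v.adicCompletion F) (LocalRing E v)).toMonoidHom r, by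
    rw [Units.coe_map, RingHom.toMonoidHom_eq_coe, MonoidHom.coe_coe, algebraMap_localRing_eq, conjLocal_toLocalRing,
      Units.val_mul, map_mul]⟩

omit [Algebra.IsQuadraticExtension F E] in
/-- at a place `v ∤ 2` the element `4 ∈ F_v` is a unit of `𝒪_v`: `v(4) = 1`. [folklore] -/
private theorem valued_four_eq_one (h2 : (2 : 𝓞 F) ∉ v.asIdeal) : Valued.v (4 : v.adicCompletion F) = 1 := by
  have h4 : (4 : 𝓞 F) ∉ v.asIdeal := by
    rw [show (4 : 𝓞 F) = 2 * 2 by norm_num]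
    exact fun h => (v.isPrime.mem_or_mem h).elim h2 h2
  have hc : (4 : v.adicCompletion F) = (((algebraMap (𝓞 F) F 4 : F)) : v.adicCompletion F) := by
    rw [map_ofNat, ← map_ofNat (algebraMap F (v.adicCompletion F)) 4, HeightOneSpectrum.algebraMap_adicCompletion]
    rfl
  rw [hc, HeightOneSpectrum.valuedAdicCompletion_eq_valuation', HeightOneSpectrum.valuation_of_algebraMap,
    HeightOneSpectrum.intValuation_eq_one_iff]
  exact h4

omit [Algebra.IsQuadraticExtension F E] in
/-- **a principal unit of `F_v` is a norm from `E_vˣ` at `v ∤ 2`**: `v(a − 1) < 1 = v(4)` makes `a` a square in `F_v` (the local square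
theorem of the tree, `QuadraticForms.isSquare_of_valued_sub_one_lt`), and squares `r²  = ι_v(r) · (c ⊗ 1) ι_v(r)` are norms.
[cite: Omeara1963, §63A Cor. 63:1b] [cite: Liu2021, App. D §D.1 Step 2 (l. 5219)] -/
theorem isNorm_of_valued_sub_one_lt (h2 : (2 : 𝓞 F) ∉ v.asIdeal) (a : (v.adicCompletion F)ˣ)
    (ha : Valued.v ((a : v.adicCompletion F) - 1) < 1) :
    ∃ x : (LocalRing E v)ˣ, (x : LocalRing E v) * conjLocal E c v x = algebraMap (v.adicCompletion F) (LocalRing E v) a := by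
  have hsq : IsSquare (a : v.adicCompletion F) :=
    QuadraticForms.isSquare_of_valued_sub_one_lt F v (by rw [valued_four_eq_one v h2]; exact ha)
  obtain ⟨r, hr⟩ := hsq
  have hr0 : r ≠ 0 := fun h => a.ne_zero (by rw [hr, h, mul_zero])
  obtain ⟨x, hx⟩ := isNorm_of_sq E v c (Units.mk0 r hr0)
  exact ⟨x, by rw [hx, Units.val_mul, Units.val_mk0, ← hr]⟩

/-- A homomorphism with open kernel is locally constant (copy of the tree's private lemma). [folklore] -/
private theorem isLocallyConstant_of_isOpen_ker {Γ G : Type*} [Group Γ] [TopologicalSpace Γ]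
    [ContinuousMul Γ] [Group G] (r : Γ →* G) (h : IsOpen (r.ker : Set Γ)) :
    IsLocallyConstant r := by
  refine (IsLocallyConstant.iff_exists_open r).2 fun σ => ⟨{τ | σ⁻¹ * τ ∈ r.ker}, ?_, ?_, ?_⟩
  · exact h.preimage (continuous_const_mul σ⁻¹)
  · show σ⁻¹ * σ ∈ r.ker
    rw [inv_mul_cancel]; exact r.ker.one_mem
  · intro τ hτ
    have hτ' : r (σ⁻¹ * τ) = 1 := hτ
    rw [map_mul, map_inv, inv_mul_eq_one] at hτ'
    exact hτ'.symm

/-- `(1/2 : ℚ/ℤ)` has order `2`: it is non-zero and `1/2 + 1/2 = 0`. [folklore] -/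
private theorem half_addCircle :
    (((1 / 2 : ℚ) : AddCircle (1 : ℚ)) ≠ 0) ∧ ((1 / 2 : ℚ) : AddCircle (1 : ℚ)) + ((1 / 2 : ℚ) : AddCircle (1 : ℚ)) = 0 := by
  constructor
  · intro h
    rw [AddCircle.coe_eq_zero_iff] at h
    obtain ⟨n, hn⟩ := h
    rw [zsmul_eq_mul, mul_one] at hn
    have h2 : (2 * n : ℤ) = 1 := by exact_mod_cast (by linear_combination 2 * hn : (2 * n : ℚ) = 1)
    omega
  · rw [← AddCircle.coe_add, show (1 / 2 + 1 / 2 : ℚ) = 1 by norm_num, AddCircle.coe_period]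

omit [Algebra.IsQuadraticExtension F E] in
/-- the `w`-component of `ι_v a` is `ι_w a` (units form). [cite: CasselsFrohlichANT1967, Ch. II §10] -/
private theorem units_map_eval_units_map_algebraMap (w : PlacesOver E v) (a : (v.adicCompletion F)ˣ) :
    Units.map (Pi.evalRingHom (fun w' : PlacesOver E v => w'.1.adicCompletion E) w).toMonoidHom
        (Units.map (algebraMap (v.adicCompletion F) (LocalRing E v)).toMonoidHom a) =
      Units.map (toPlace v w).toMonoidHom a :=
  Units.ext (by
    rw [Units.coe_map, Units.coe_map, Units.coe_map, RingHom.toMonoidHom_eq_coe, MonoidHom.coe_coe, RingHom.toMonoidHom_eq_coe,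
      MonoidHom.coe_coe, RingHom.toMonoidHom_eq_coe, MonoidHom.coe_coe, algebraMap_localRing_eq]
    rfl)

include hcδ hδ in
/-- **A STEP-2 DATUM AT EVERY NON-SPLIT PLACE `∤ 2` OF ANY QUADRATIC `E/F`** (inert OR RAMIFIED): at a place `w ∣ v` fixed by `c` with
`v ∤ 2` there is `μ : E_vˣ → ℂˣ` unitary, continuous, trivial on the units `u` with `v_w(u_w − 1) < 1` (tame), satisfying the printed clause
«`μ(ι_v a) = 1 ↔ a ∈ Nm E_vˣ`» («`μ|_{F^×}` is the unique character whose kernel is exactly `Nm_{E/F} E^×`»).  Construction: the norm group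
`N ≤ F_vˣ` has index `2` (`…NonsplitPlace`); the `ℚ/ℤ`-valued norm-class character `c_N` of `F_vˣ` (`0` on `N`, `1/2` off `N`) is
trivial on the `a` with `ι_w a ≡ 1 (mod 𝔭_w)` (such `a` are principal units of `F_v`, hence squares — the local square theorem at
`v ∤ 2` — hence norms), so it extends along `F_vˣ → E_wˣ/U¹_w` to a `ℚ/ℤ`-valued character `φ` of `E_wˣ/U¹_w` (`ℚ/ℤ` is divisible: the
tree's `ClozelHarrisTaylor2008.exists_character_comp_eq`); `μ = e^{2πiφ}` composed with the `w`-projection `E_vˣ → E_wˣ`.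
[cite: Liu2021, App. D §D.1 Step 2 (l. 5219)] [cite: NeukirchANT1999, Ch. V §1 Thm. (1.3)] [cite: ClozelHarrisTaylor2008, Lemma 4.1.1 (p. 116), proof] -/
theorem exists_stepTwo_of_nonsplit (w : PlacesOver E v) (hw : c • w.1 = w.1) (h2 : (2 : 𝓞 F) ∉ v.asIdeal) :
    ∃ (μ : (LocalRing E v)ˣ →* ℂˣ) (_ : ∀ x, ‖((μ x : ℂˣ) : ℂ)‖ = 1) (_ : Continuous fun x => ((μ x : ℂˣ) : ℂ))
      (_ : ∀ a : (v.adicCompletion F)ˣ,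
        μ (Units.map (algebraMap (v.adicCompletion F) (LocalRing E v)).toMonoidHom a) = 1 ↔
          ∃ x : (LocalRing E v)ˣ, (x : LocalRing E v) * conjLocal E c v x =
            algebraMap (v.adicCompletion F) (LocalRing E v) a),
      ∀ u : (LocalRing E v)ˣ, Valued.v ((u : LocalRing E v) w - 1) < 1 → μ u = 1 := by
  classical
  obtain ⟨d, hd⟩ := exists_delta_mul_self_eq_algebraMap E c hcδ hδ
  have hNiff := fun a => LemD1IndexedNonVacuityNonsplitPlace.isNorm_iff_mem_quadraticNormSubgroup E v c hcδ hδ hd a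
  have hidx := LemD1IndexedNonVacuityNonsplitPlace.index_norms_eq_two_of_nonsplit E v c hcδ hδ w hw hd
  set Nm := quadraticNormSubgroup (v.adicCompletion F) (d : v.adicCompletion F) with hNm
  obtain ⟨hhalf0, hhalf2⟩ := half_addCircle
  -- the ℚ/ℤ-valued norm class character of `F_vˣ`
  let cN : (v.adicCompletion F)ˣ → AddCircle (1 : ℚ) := fun a => if a ∈ Nm then 0 else ((1 / 2 : ℚ) : AddCircle (1 : ℚ))
  have hcN_mem : ∀ a, a ∈ Nm → cN a = 0 := fun a ha => if_pos ha
  have hcN_not : ∀ a, a ∉ Nm → cN a = ((1 / 2 : ℚ) : AddCircle (1 : ℚ)) := fun a ha => if_neg ha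
  have hcN_zero_iff : ∀ a, cN a = 0 ↔ a ∈ Nm := fun a =>
    ⟨fun h => by_contra fun ha => hhalf0 (by rw [← hcN_not a ha, h]), hcN_mem a⟩
  have hcN_add : ∀ a b, cN (a * b) = cN a + cN b := by
    intro a b
    by_cases ha : a ∈ Nm <;> by_cases hb : b ∈ Nm
    · rw [hcN_mem a ha, hcN_mem b hb, hcN_mem _ (Nm.mul_mem ha hb), add_zero]
    · have hab : a * b ∉ Nm := fun h => hb (by simpa using Nm.mul_mem (Nm.inv_mem ha) h)
      rw [hcN_mem a ha, hcN_not b hb, hcN_not _ hab, zero_add]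
    · have hab : a * b ∉ Nm := fun h => ha (by simpa using Nm.mul_mem h (Nm.inv_mem hb))
      rw [hcN_not a ha, hcN_mem b hb, hcN_not _ hab, add_zero]
    · have hab : a * b ∈ Nm := (Subgroup.mul_mem_iff_of_index_two hidx).2 (iff_of_false ha hb)
      rw [hcN_not a ha, hcN_not b hb, hcN_mem _ hab, hhalf2]
  -- `F_vˣ → E_wˣ / U¹_w`
  let U : Subgroup (w.1.adicCompletion E)ˣ := (w.1.adicCompletionIntegers E).principalUnitGroup
  have hU : ∀ x : (w.1.adicCompletion E)ˣ, x ∈ U ↔ Valued.v ((x : w.1.adicCompletion E) - 1) < 1 := fun x => by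
    rw [ValuationSubring.mem_principalUnitGroup_iff]
    exact ((Valuation.isEquiv_valuation_valuationSubring Valued.v).lt_one_iff_lt_one).symm
  let ιw : (v.adicCompletion F)ˣ →* (w.1.adicCompletion E)ˣ := Units.map (toPlace v w).toMonoidHom
  let g : (v.adicCompletion F)ˣ →* (w.1.adicCompletion E)ˣ ⧸ U := (QuotientGroup.mk' U).comp ιw
  have hker : ∀ a, g a = 1 → cN a = 0 := by
    intro a ha
    have ha' : ιw a ∈ U := by
      rw [MonoidHom.comp_apply, QuotientGroup.mk'_apply, QuotientGroup.eq_one_iff] at ha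
      exact ha
    rw [hU] at ha'
    have hv : Valued.v ((a : v.adicCompletion F) - 1) < 1 := by
      have h1 : ((ιw a : (w.1.adicCompletion E)ˣ) : w.1.adicCompletion E) - 1 = toPlace v w ((a : v.adicCompletion F) - 1) := by
        rw [map_sub, map_one]; rfl
      rw [h1, valued_toPlace] at ha'
      by_contra hge
      exact absurd ha' (not_lt.2 (one_le_pow_of_one_le' (not_lt.1 hge) _))
    exact hcN_mem a ((hNiff a).1 (isNorm_of_valued_sub_one_lt E v c h2 a hv))
  obtain ⟨φ, hφadd, hφg⟩ :=
    GaloisRepresentations.ClozelHarrisTaylor2008.exists_character_comp_eq (Q := (w.1.adicCompletion E)ˣ ⧸ U) g cN hcN_add hker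
  -- restate additivity with the default instance path on the quotient
  have hφadd' : ∀ x y : (w.1.adicCompletion E)ˣ ⧸ U, φ (x * y) = φ x + φ y := hφadd
  have hφ0 : φ 1 = 0 := by
    have h := hφg 1
    rwa [map_one, hcN_mem 1 Nm.one_mem] at h
  obtain ⟨e, he0, headd, heinj, henorm⟩ := exists_addCircle_character
  -- the character of `E_wˣ` and of `E_vˣ`
  let μw : (w.1.adicCompletion E)ˣ →* ℂˣ :=
    { toFun := fun x => e (φ (x : (w.1.adicCompletion E)ˣ ⧸ U))
      map_one' := by rw [QuotientGroup.mk_one, hφ0, he0]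
      map_mul' := fun x y => by rw [QuotientGroup.mk_mul, hφadd', headd] }
  have hμw : ∀ x, μw x = e (φ (x : (w.1.adicCompletion E)ˣ ⧸ U)) := fun x => rfl
  have hμwU : ∀ x, x ∈ U → μw x = 1 := fun x hx => by
    rw [hμw, (QuotientGroup.eq_one_iff x).2 hx, hφ0, he0]
  let prw : (LocalRing E v)ˣ →* (w.1.adicCompletion E)ˣ :=
    Units.map (Pi.evalRingHom (fun w' : PlacesOver E v => w'.1.adicCompletion E) w).toMonoidHom
  have hprw : ∀ y : (LocalRing E v)ˣ, ((prw y : (w.1.adicCompletion E)ˣ) : w.1.adicCompletion E) = (y : LocalRing E v) w :=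
    fun y => rfl
  have htame : ∀ u : (LocalRing E v)ˣ, Valued.v ((u : LocalRing E v) w - 1) < 1 → (μw.comp prw) u = 1 := fun u hu => by
    rw [MonoidHom.comp_apply]
    exact hμwU _ ((hU _).2 (by rw [hprw]; exact hu))
  refine ⟨μw.comp prw, fun x => henorm _, ?_, fun a => ?_, htame⟩
  · -- continuity: open kernel
    have hopen : IsOpen ((μw.comp prw).ker : Set (LocalRing E v)ˣ) := by
      refine Subgroup.isOpen_of_mem_nhds _ (g := 1) ?_
      have h1 : {y : w.1.adicCompletion E | Valued.v (y - 1) < 1} ∈ nhds (((1 : (LocalRing E v)ˣ) : LocalRing E v) w) := by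
        rw [Units.val_one, Pi.one_apply, Valued.mem_nhds]
        exact ⟨1, fun y hy => by simpa only [Set.mem_setOf_eq, Units.val_one, Valuation.restrict_lt_one_iff] using hy⟩
      have h2' := ((continuous_apply w).comp Units.continuous_val).continuousAt.preimage_mem_nhds h1
      exact Filter.mem_of_superset h2' fun x hx => htame x hx
    exact Units.continuous_val.comp (isLocallyConstant_of_isOpen_ker _ hopen).continuous
  · -- the printed clause
    rw [MonoidHom.comp_apply, units_map_eval_units_map_algebraMap E v w a, hμw]
    change e (φ (g a)) = 1 ↔ _
    rw [hφg, ← he0, heinj.eq_iff, hcN_zero_iff]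
    exact (hNiff a).symm

/-! ## §3 Consequences: `MuSet` non-empty at every place `∤ 2` of any quadratic `E/F`; two elements; ramified places; teeth; cofinite -/

variable (N : ℕ) (J : Matrix (Fin N) (Fin N) E) (hN : 2 ≤ N) (hJh : (J.map c)ᵀ = J) (hJdet : J.det ≠ 0)

include hcδ in
/-- **`MuSet` is NON-EMPTY at every non-split place `∤ 2` of ANY quadratic `E/F`** — the RAMIFIED places included — with an element
trivial on the units `≡ 1 (mod 𝔭_w)` («tame»), packaged by `LemD1OfPlace.muOf`. [cite: Liu2021, App. D §D.1 Step 2 (l. 5219)] -/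
theorem exists_muSet_tame_of_nonsplit (w : PlacesOver E v) (hw : c • w.1 = w.1) (h2 : (2 : 𝓞 F) ∉ v.asIdeal) :
    ∃ μ : LemD1.MuSet (LemD1OfPlace.standingData E v c N J hcδ hδ hN hJh hJdet),
      ∀ u : (LocalRing E v)ˣ, Valued.v ((u : LocalRing E v) w - 1) < 1 → μ.1 u = 1 := by
  obtain ⟨μ, hμn, hμc, hμF, htame⟩ := exists_stepTwo_of_nonsplit E v c hcδ hδ w hw h2
  exact ⟨LemD1OfPlace.muOf E v c N J hcδ hδ hN hJh hJdet μ hμn hμc hμF, htame⟩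

include hcδ in
/-- **`MuSet` is NON-EMPTY at EVERY place `v ∤ 2` of ANY quadratic `E/F`** (split: the trivial character,
`LemD1IndexedNonVacuityAtPlace.one_mem_muSet_of_split`; non-split: the extension of this file): Step 2 of [Liu2021, App. D §D.1] is
performable in the place model at every place `∤ 2` without any global input (the tree had: split places; inert places, `…InertSign`;
all places for the CM rows, `…NonsplitPlace`). [cite: Liu2021, App. D §D.1 Step 2 (l. 5219)] -/
theorem nonempty_muSet_of_not_two_mem (h2 : (2 : 𝓞 F) ∉ v.asIdeal) :
    Nonempty (LemD1.MuSet (LemD1OfPlace.standingData E v c N J hcδ hδ hN hJh hJdet)) := by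
  obtain ⟨w⟩ := (inferInstance : Nonempty (PlacesOver E v))
  by_cases hw : c • w.1 = w.1
  · obtain ⟨μ, -⟩ := exists_muSet_tame_of_nonsplit E v c hcδ hδ N J hN hJh hJdet w hw h2
    exact ⟨μ⟩
  · obtain ⟨h1, h2', h3⟩ := LemD1IndexedNonVacuityAtPlace.one_mem_muSet_of_split E v c w hw
    exact ⟨LemD1OfPlace.muOf E v c N J hcδ hδ hN hJh hJdet 1 h1 h2' h3⟩

include hcδ in
/-- **TWO elements at every non-split place `∤ 2`** (the tame twist of `LemD1IndexedNonVacuityTameTwist` applied to the element above).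
[cite: Liu2021, App. D §D.1 Step 2 (l. 5219)] -/
theorem exists_muSet_ne_of_nonsplit (w : PlacesOver E v) (hw : c • w.1 = w.1) (h2 : (2 : 𝓞 F) ∉ v.asIdeal) :
    ∃ μ₀ μ₁ : LemD1.MuSet (LemD1OfPlace.standingData E v c N J hcδ hδ hN hJh hJdet), μ₀ ≠ μ₁ := by
  obtain ⟨μ₀, -⟩ := exists_muSet_tame_of_nonsplit E v c hcδ hδ N J hN hJh hJdet w hw h2
  obtain ⟨μ₁, hne, -⟩ := LemD1IndexedNonVacuityTameTwist.exists_muSet_ne_twist E v c hcδ hδ N J hN hJh hJdet w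
    (LemD1IndexedNonVacuityTameTwist.two_not_mem_of_placesOver E v w h2) μ₀
  exact ⟨μ₀, μ₁, fun h => hne h.symm⟩

include hcδ in
/-- **at a RAMIFIED non-split place `∤ 2` of any quadratic `E/F`: the printed Step-2 index set is non-empty and ALL its elements are
ramified** (`LemD1IndexedNonVacuityRamifiedPlace.not_unramified_muSet_of_ramified`) — in contrast with the inert places (exactly one
unramified element, `…InertSign.existsUnique_muSet_unramified_of_inertWitness`). [cite: Liu2021, App. D §D.1 Step 2 (l. 5219)]
[cite: NeukirchANT1999, Ch. V §1 Cor. (1.2)] -/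
theorem exists_muSet_and_forall_not_unramified_of_ramified (w : PlacesOver E v) (hw : c • w.1 = w.1)
    (h2 : (2 : 𝓞 F) ∉ v.asIdeal) (he : v.asIdeal.ramificationIdx' w.1.asIdeal ≠ 1) :
    Nonempty (LemD1.MuSet (LemD1OfPlace.standingData E v c N J hcδ hδ hN hJh hJdet)) ∧
      ∀ μ : LemD1.MuSet (LemD1OfPlace.standingData E v c N J hcδ hδ hN hJh hJdet),
        ¬ ∀ u : (LocalRing E v)ˣ, Valued.v ((u : LocalRing E v) w) = 1 → μ.1 u = 1 := by
  obtain ⟨μ, -⟩ := exists_muSet_tame_of_nonsplit E v c hcδ hδ N J hN hJh hJdet w hw h2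
  exact ⟨⟨μ⟩, fun μ' => LemD1IndexedNonVacuityRamifiedPlace.not_unramified_muSet_of_ramified E v c hcδ hδ N J hN hJh hJdet w hw he μ'⟩

include hcδ in
/-- **the μ-teeth of [Lem. D.1 (3)] AS PRINTED at EVERY place `v ∤ 2` of ANY quadratic `E/F`, with NO input datum** (rank `N ≥ 3`;
`LemD1IndexedNonVacuityTameTwist.not_forall_lemD1_3_of_item1_twist` fed with the element of `nonempty_muSet_of_not_two_mem`): on two-member
collections over the place model, (3) AS PRINTED is not a consequence of (1). [cite: Liu2021, App. D Lemma D.1 (1) and (3) (l. 5229, 5233)] -/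
theorem not_forall_lemD1_3_of_item1_of_not_two_mem (h2 : (2 : 𝓞 F) ∉ v.asIdeal) (h3 : 3 ≤ N) :
    ¬ ∀ Lf : LemD1IndexedFamily (v.adicCompletion F) (LocalRing E v) N (Fin 2),
        Lf.S = LemD1OfPlace.standingData E v c N J hcδ hδ hN hJh hJdet → Lf.Item1AsPrinted → LemD1_3AsPrintedI Lf := by
  obtain ⟨w⟩ := (inferInstance : Nonempty (PlacesOver E v))
  exact LemD1IndexedNonVacuityTameTwist.not_forall_lemD1_3_of_item1_twist E v c hcδ hδ N J hN hJh hJdet w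
    (LemD1IndexedNonVacuityTameTwist.two_not_mem_of_placesOver E v w h2) h3
    (nonempty_muSet_of_not_two_mem E v c hcδ hδ N J hN hJh hJdet h2)

include hcδ in
/-- **the joint certificate «(1) for every member ∧ (3)» with TWO μ-labels at EVERY place `v ∤ 2` of ANY quadratic `E/F`, with NO
input datum** (`N` odd `≥ 3`; `LemD1IndexedNonVacuityTameCarrier.not_forall_mu_eq_twist` fed with the element of
`nonempty_muSet_of_not_two_mem`): the two displayed records do not force «all members carry the same `μ`».
[cite: Liu2021, App. D Lemma D.1 (1) and (3) (l. 5229, 5233)] -/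
theorem not_forall_mu_eq_of_not_two_mem (h2 : (2 : 𝓞 F) ∉ v.asIdeal) (hNo : Odd N) (h3 : 3 ≤ N) :
    ¬ ∀ Lf : LemD1IndexedFamily (v.adicCompletion F) (LocalRing E v) N (Fin 2),
        Lf.S = LemD1OfPlace.standingData E v c N J hcδ hδ hN hJh hJdet →
        Lf.Item1AsPrinted → LemD1_3AsPrintedI Lf → ∀ i j : Fin 2, Lf.mu i = Lf.mu j := by
  obtain ⟨w⟩ := (inferInstance : Nonempty (PlacesOver E v))
  exact LemD1IndexedNonVacuityTameCarrier.not_forall_mu_eq_twist E v c hcδ hδ N J hN hJh hJdet w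
    (LemD1IndexedNonVacuityTameTwist.two_not_mem_of_placesOver E v w h2) hNo h3
    (nonempty_muSet_of_not_two_mem E v c hcδ hδ N J hN hJh hJdet h2)

/-- all but finitely many places of `F` are `∤ 2` (Mathlib `Ideal.finite_factors`). [folklore] -/
private theorem finite_setOf_two_mem : {v : HeightOneSpectrum (𝓞 F) | (2 : 𝓞 F) ∈ v.asIdeal}.Finite := by
  have h := Ideal.finite_factors (I := Ideal.span {(2 : 𝓞 F)}) (by
    rw [Ideal.zero_eq_bot, Ne, Ideal.span_singleton_eq_bot]; exact two_ne_zero)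
  refine h.subset fun v hv => ?_
  simp only [Set.mem_setOf_eq] at hv ⊢
  rw [Ideal.dvd_span_singleton]
  exact hv

include hcδ in
/-- **cofinite form, ANY quadratic `E/F`, ALL places**: at all but finitely many places `v` of `F` (off the prime factors of `2`), for every
hermitian `J`, the printed Step-2 index set of the place model at `v` is non-empty. [cite: Liu2021, App. D §D.1 Step 2 (l. 5219)]
[cite: NeukirchANT1999, Ch. I §8] -/
theorem eventually_nonempty_muSet :
    ∀ᶠ v : HeightOneSpectrum (𝓞 F) in Filter.cofinite,
      ∀ (J : Matrix (Fin N) (Fin N) E) (hJh : (J.map c)ᵀ = J) (hJdet : J.det ≠ 0),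
        Nonempty (LemD1.MuSet (LemD1OfPlace.standingData E v c N J hcδ hδ hN hJh hJdet)) :=
  Filter.Eventually.mono (finite_setOf_two_mem (F := F)).compl_mem_cofinite fun v hv J hJh hJdet =>
    nonempty_muSet_of_not_two_mem E v c hcδ hδ N J hN hJh hJdet hv

end PlaceModel

end Literature.NumberTheory.Automorphic.Liu2021.LemD1IndexedNonVacuityNormClassExtension

end
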